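import Literature.AlgebraicGeometry.ShimuraVarieties.UnitaryCurveSiegelPointMap                -- ★ FILE A (A-p01): `siegelShimuraSet_mk_eq_of_gs_mk_eq` (the class `[J v, b a]` is well defined), `ShimuraSetGS`, `SiegelShimuraSet`
import Literature.AlgebraicGeometry.Motives.BaseChange                                          -- ★ `AlgPoints.baseChangeEquiv` (the `ℚ`-points currency of the chart՚s `f_pts`)
import HarnessLib

/-!
# The TWISTED Siegel class `[J v, b(a)·u]` is well defined on the complex points of the unitary Shimura curve; the twisted point map `f₂`
# ([Deligne 1971] Prop. 1.15; [Milne 2005] Lemma 5.13; [Shimura 1998] §18.6: the central translate `ũ_V(1, t)` of the Serre tensor)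

Topic `AlgebraicGeometry/ShimuraVarieties`; namespace `…ShimuraVarieties.UnitaryCurve` (the chart currency of ★ FILE A `UnitaryCurveSiegelPointMap`).
THEOREMS ONLY (no definition, no instance, no notation, no named fact, no `sorry`).  Cell `hodgecm-mathlib` (D-0151), P6 «MOD programme», crux hLiu418
(stmt-HodgeConjecture-24832, `--supports`, count-neutral), line «L4», closer `stub_SHEET` ROAD B′∕(β) (LA4-plan (g2) 2026-09-02, DEAL #37 «`f₂` + the global
point law on the twisted sheet», LA4-p01 (g3)): THE POINT MAP `f₂` ITSELF.  In road B′ the Serre-tensored marked fibre over the complex point `[v, aK]` is classified by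
the Siegel point `pts⁻¹[J v, b(a)·ũ_V(1, t)]` ((S2b), ★ p849685), `t = N_Φ(u)` the reflex norm of the junction՚s idèle; the comparison with the conjugate slice
(★ `UnitaryCurveTwistedSheetPointLaw`, ★ p850424 density, ★ p850443 continuity) needs this assignment as a FUNCTION on `Sh_K(ℂ)`, i.e. the class
`[J v, b(a)·u]` must not depend on the representative `(v, a)`.  It does not as soon as `u` commutes with `b(K)` — for `u = ũ_V(1, t)` and `b = ũ_V(·, 1)` this holds
because `ũ_V` is a homomorphism on the PRODUCT group `U(V)(𝔸_f) × T(𝔸_f)`: ★ FILE A՚s proof with the factor `u` carried on the right (`(b(γa′)u)⁻¹(b(a)u) =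
u⁻¹b(k)u = b(k) ∈ K_δ(N)`).

* `siegelShimuraSet_mk_mul_eq_of_gs_mk_eq` — `[v, aK] = [v′, a′K] ⇒ [J v, b(a)·u] = [J v′, b(a′)·u]`;
* **`exists_siegelPointMapGS_mul`** — the class map `[v, aK] ↦ [J v, b(a)·u]`;
* **`exists_pointMap_of_shadow_mul`** — a point map `f₂ : Sh_K(ℂ) → M(ℂ)` with shadow `pts (bce (f₂ [v, aK])) = [J v, b(a)·u]` (the chart՚s `f_pts` currency).
HONEST LABEL: HC_CM is proved only modulo the 2 remaining named inputs (hLiu418 24832, h413 24833) until rung 0 closes; this file is generic and count-neutral.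

## References
* [Deligne1971TravauxShimura] P. Deligne, *Travaux de Shimura* (1971), Prop. 1.15 p. 132.
* [Milne2005ShimuraVarieties] J. S. Milne, *Introduction to Shimura varieties* (2005), Lemma 5.13 p. 57, Thm. 6.11 p. 74.
* [Shimura1998] G. Shimura, *Abelian Varieties with Complex Multiplication and Modular Functions* (1998), §18.6 (pp. 124–128).
-/

set_option autoImplicit false

noncomputable section

open Function MulAction NumberField IsDedekindDomain CategoryTheory CategoryTheory.Limits Matrix AlgebraicGeometry
open scoped Matrix ComplexOrder
open Literature.AlgebraicGeometry.Motives (SchemeOver ComplexPoints AlgPoints)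
open Literature.NumberTheory.Automorphic Literature.NumberTheory.Automorphic.UnitaryGroup
open Literature.AlgebraicGeometry.ModuliOfAbelianVarieties

namespace Literature.AlgebraicGeometry.ShimuraVarieties

/-! ### §1 The twisted Siegel class `[J v, b(a)·u]` is well defined on `Sh_K(ℂ)`; the point map `f₂` -/

namespace UnitaryCurve

open UnitaryCanonicalModel

variable {L : Type} [Field L] [NumberField L] [IsCMField L] {Jstar : Matrix (Fin 2) (Fin 2) L} {τ : L →+* ℂ}
variable {g : ℕ} {δ : Fin g → ℕ} {N : ℕ}
variable (J : (Fin 2 → ℂ) → Matrix (Fin g ⊕ Fin g) (Fin g ⊕ Fin g) ℝ)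
  (hJ : ∀ v : Fin 2 → ℂ, v ∈ negCone (Jstar.map τ) → J v ∈ C0pm δ)
  (b : ↥(finAdelic (↥(maximalRealSubfield L)) L (IsCMField.complexConj L) 2 Jstar) →* ↥(gspFinAdelic δ))
  (bq : ↥(rational (↥(maximalRealSubfield L)) L (IsCMField.complexConj L) 2 Jstar) →* ↥(gspRational δ))
  (hJsmul : ∀ c : ℂ, c ≠ 0 → ∀ v : Fin 2 → ℂ, v ∈ negCone (Jstar.map τ) → J (c • v) = J v)
  (hb : ∀ γ : ↥(rational (↥(maximalRealSubfield L)) L (IsCMField.complexConj L) 2 Jstar),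
    b (rationalToFinAdelic (↥(maximalRealSubfield L)) L (IsCMField.complexConj L) 2 Jstar γ) = gspRationalToFinAdelic δ (bq γ))
  (hJrat : ∀ (γ : ↥(rational (↥(maximalRealSubfield L)) L (IsCMField.complexConj L) 2 Jstar)) (v : Fin 2 → ℂ),
    v ∈ negCone (Jstar.map τ) →
      J (((ratToGLℂ L Jstar τ γ : GL (Fin 2) ℂ) : Matrix (Fin 2) (Fin 2) ℂ) *ᵥ v) =
        conjJ ((gspRationalToReal δ (bq γ) : ↥(gspReal δ)) : GL (Fin g ⊕ Fin g) ℝ) (J v))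
  (K : Subgroup ↥(finAdelic (↥(maximalRealSubfield L)) L (IsCMField.complexConj L) 2 Jstar))
  (hle : K ≤ (principalLevelSubgroup δ N).comap b)
  (u : ↥(gspFinAdelic δ)) (hu : ∀ k ∈ K, b k * u = u * b k)

include hJsmul hb hJrat hle hu in
/-- **The TWISTED Siegel point `[J(v), b(a)·u·K_δ(N)]` depends only on the class `[v, aK]`** when `u` commutes with `b(K)` — ★ `siegelShimuraSet_mk_eq_of_gs_mk_eq`
with the right factor `u` carried along: the same rational mover `bq γ` works, and `(b(γa′)u)⁻¹ (b(a)u) = u⁻¹ b(k) u = b(k) ∈ K_δ(N)` for `k := (γa′)⁻¹a ∈ K`.  USE: `u := ũ_V(1, t)`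
against `b := ũ_V(·, 1)` (commuting: `ũ_V` is a homomorphism on the product `G × T`). [cite: Deligne1971TravauxShimura, Prop. 1.15 p. 132] [cite: Milne2005ShimuraVarieties, Lemma 5.13 p. 57]
[cite: Shimura1998, §18.6 (pp. 124–128)] -/
theorem siegelShimuraSet_mk_mul_eq_of_gs_mk_eq
    {v v' : Fin 2 → ℂ} {hv : v ∈ negCone (Jstar.map τ)} {hv' : v' ∈ negCone (Jstar.map τ)}
    {a a' : ↥(finAdelic (↥(maximalRealSubfield L)) L (IsCMField.complexConj L) 2 Jstar)}
    (h : ShimuraSetGS.mk L Jstar τ K v hv a = ShimuraSetGS.mk L Jstar τ K v' hv' a') :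
    SiegelShimuraSet.mk δ (principalLevelSubgroup δ N) ⟨J v, hJ v hv⟩ (b a * u) =
      SiegelShimuraSet.mk δ (principalLevelSubgroup δ N) ⟨J v', hJ v' hv'⟩ (b a' * u) := by
  -- the unitary relation: `c • γ^τ v' = v`, `γ • a'K = aK`
  obtain ⟨γ, c, hc, hcv, hk⟩ := (ShimuraSetGS.mk_eq_mk_iff L Jstar τ K v v' hv hv' a a').1 h
  have hγv' : ((ratToGLℂ L Jstar τ γ : GL (Fin 2) ℂ) : Matrix (Fin 2) (Fin 2) ℂ) *ᵥ v' = c⁻¹ • v := by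
    rw [← hcv, smul_smul, inv_mul_cancel₀ hc, one_smul]
  have hγv'mem : ((ratToGLℂ L Jstar τ γ : GL (Fin 2) ℂ) : Matrix (Fin 2) (Fin 2) ℂ) *ᵥ v' ∈ negCone (Jstar.map τ) := by
    rw [hγv']
    exact smul_mem_negCone (inv_ne_zero hc) hv
  -- `k := (γ_𝔸 a')⁻¹ a ∈ K`
  have hkK : (rationalToFinAdelic (↥(maximalRealSubfield L)) L (IsCMField.complexConj L) 2 Jstar γ * a')⁻¹ * a ∈ K := by
    rw [MulAction.Quotient.smul_mk, smul_eq_mul, QuotientGroup.eq] at hk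
    exact hk
  refine (SiegelShimuraSet.mk_eq_mk_iff δ (principalLevelSubgroup δ N) _ _ _ _).2 ⟨bq γ, ?_, ?_⟩
  · -- equivariance of the complex structure
    apply Subtype.ext
    rw [coe_conjAct]
    change conjJ _ (J v') = J v
    rw [← hJrat γ v' hv', hγv', hJsmul c⁻¹ (inv_ne_zero hc) v hv]
  · -- the finite-adelic classes: `(bq γ)_𝔸 · b a' · u = b (γ_𝔸 a') · u` and `(b (γ_𝔸 a') u)⁻¹ (b a u) = b ((γ_𝔸 a')⁻¹ a) ∈ K_δ(N)`
    rw [← hb, MulAction.Quotient.smul_mk, smul_eq_mul, ← mul_assoc, ← map_mul]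
    apply QuotientGroup.eq.2
    rw [_root_.mul_inv_rev, mul_assoc, ← mul_assoc (b _)⁻¹, ← map_inv, ← map_mul, hu _ hkK, ← mul_assoc, inv_mul_cancel, one_mul]
    exact hle hkK

include hJsmul hb hJrat hle hu in
/-- **THE TWISTED CLASS MAP `[v, aK] ↦ [J(v), b(a)·u·K_δ(N)]` EXISTS** on `Sh_K(ℂ)` (a section of `ShimuraSetGS.mk` composed with the twisted Siegel class;
`siegelShimuraSet_mk_mul_eq_of_gs_mk_eq`). [cite: Deligne1971TravauxShimura, Prop. 1.15 p. 132] [cite: Milne2005ShimuraVarieties, Lemma 5.13 p. 57] -/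
theorem exists_siegelPointMapGS_mul :
    ∃ φ : ShimuraSetGS L Jstar τ K → SiegelShimuraSet δ (principalLevelSubgroup δ N),
      ∀ (v : Fin 2 → ℂ) (hv : v ∈ negCone (Jstar.map τ)) (a : ↥(finAdelic (↥(maximalRealSubfield L)) L (IsCMField.complexConj L) 2 Jstar)),
        φ (ShimuraSetGS.mk L Jstar τ K v hv a) = SiegelShimuraSet.mk δ (principalLevelSubgroup δ N) ⟨J v, hJ v hv⟩ (b a * u) := by
  classical
  have hs := ShimuraSetGS.mk_surjective L Jstar τ K
  choose sv shv sa hmk using hs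
  refine ⟨fun x => SiegelShimuraSet.mk δ (principalLevelSubgroup δ N) ⟨J (sv x), hJ _ (shv x)⟩ (b (sa x) * u), fun v hv a => ?_⟩
  exact siegelShimuraSet_mk_mul_eq_of_gs_mk_eq J hJ b bq hJsmul hb hJrat K hle u hu (hmk (ShimuraSetGS.mk L Jstar τ K v hv a))

include hJsmul hb hJrat hle hu in
/-- **THE TWISTED POINT MAP `f₂ : Sh_K(ℂ) → M(ℂ)`** with Siegel shadow `pts (bce (f₂ [v, aK])) = [J v, b(a)·u]`, for a `ℚ`-scheme `M` whose complexified
complex points are put in bijection with the Siegel double coset by `pts` (the chart՚s `f_pts` currency with the twisted factor `u`; `bce := AlgPoints.baseChangeEquiv`).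
This is the `f₂` of road B′ at `u := ũ_V(1, t)`. [cite: Milne2005ShimuraVarieties, Lemma 5.13 p. 57, Thm. 6.11 p. 74] [cite: Shimura1998, §18.6 (pp. 124–128)] -/
theorem exists_pointMap_of_shadow_mul (M : SchemeOver ℚ)
    (pts : ComplexPoints ((Motives.baseChange ℚ ℂ).obj M) ≃ SiegelShimuraSet δ (principalLevelSubgroup δ N)) :
    ∃ f₂ : ShimuraSetGS L Jstar τ K → ComplexPoints M,
      ∀ (v : Fin 2 → ℂ) (hv : v ∈ negCone (Jstar.map τ)) (a : ↥(finAdelic (↥(maximalRealSubfield L)) L (IsCMField.complexConj L) 2 Jstar)),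
        pts (AlgPoints.baseChangeEquiv (algebraMap ℚ ℂ) M (f₂ (ShimuraSetGS.mk L Jstar τ K v hv a))) =
          SiegelShimuraSet.mk δ (principalLevelSubgroup δ N) ⟨J v, hJ v hv⟩ (b a * u) := by
  obtain ⟨φ, hφ⟩ := exists_siegelPointMapGS_mul J hJ b bq hJsmul hb hJrat K hle u hu
  refine ⟨fun x => (AlgPoints.baseChangeEquiv (algebraMap ℚ ℂ) M).symm (pts.symm (φ x)), fun v hv a => ?_⟩
  rw [Equiv.apply_symm_apply, Equiv.apply_symm_apply, hφ]

end UnitaryCurve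

end Literature.AlgebraicGeometry.ShimuraVarieties

end
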